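import Literature.NumberTheory.LFunctions.WeilBochnerRepresentationChar
import Literature.NumberTheory.LFunctions.WeilExplicitApproxIdentityChar
import Literature.NumberTheory.LFunctions.WeilSquareMollifier
import HarnessLib

/-!
# RiemannHypothesis (GRH arm) — the Bochner–Kreĭn measure of a `χ`-window integrates band-limited kernels

Helper file (`--supports stmt-RiemannHypothesis-0098`), GRH-free, standard axioms.  Seat rh-explicit
weil-3 (structure).  The `χ`-twin of `WeilBochnerMeasureKernel.lean`.

Let `μ` be ANY positive measure representing Weil's form `W_χ` of a Dirichlet character `χ` on the
window `[-b, b]` (`‖ĝ(½+it)‖² ∈ L¹(μ)` and `W_χ(g ⋆ g̃) = ∫ ‖ĝ(½+it)‖² dμ` for all smooth tests `g`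
supported in `[-b, b]`: hypothesis `hμ`, the conclusion of
`Literature.NumberTheory.LFunctions.WeilBochnerChar.exists_measure_of_weilPositivityOnChar`).

* `integrable_archChar_of_decay`: a continuous compactly supported kernel `k` with
  `‖k̂(½+iu)‖ ≤ M/(1+u²)` has an integrable shifted archimedean integrand
  `k̂(½+it) Re ψ(¼ + a/2 + it/2)`;
* **`weilFunctionalChar_kernel_eq_integral`**: if moreover `tsupport k ⊆ [-a, a]` with `a < 2b` and
  `k̂(½+iu)` is a nonnegative real for every real `u`, then `k̂(½+i·) ∈ L¹(μ)` and
  `W_χ(k) = ∫ k̂(½+it) dμ(t)` (square mollifiers, Boas–Kac at level `b`,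
  `WeilApproxIdentityChar.tendsto_weilFunctionalChar`, Fatou + dominated convergence — verbatim the
  `ζ` proof, which uses only real-linearity of the functional on tests).

This is the bridge from the `χ`-rung's measure to Selberg's band-limited kernels (the counting law of
the GRH arm, to be assembled as for `ζ`).
-/

noncomputable section

set_option linter.dupNamespace false  -- the mandated namespace repeats `RiemannHypothesis`

open Complex Filter Set MeasureTheory
open scoped Real Topology ContDiff ComplexConjugate
open Literature.NumberTheory.LFunctions Literature.NumberTheory.LFunctions.WeilContinuous
  Literature.NumberTheory.LFunctions.WeilSquareMollifier

namespace Summit.RiemannHypothesis.RiemannHypothesis.Theorems.WeilBochnerMeasureChar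

variable {q : ℕ} (χ : DirichletCharacter ℂ q) {b : ℝ} {μ : Measure ℝ}

/-! ## Integrability of the archimedean integrand from quadratic decay -/

/-- A continuous compactly supported kernel whose transform decays like `M/(1+u²)` on the critical
line has an integrable shifted archimedean integrand `t ↦ k̂(½+it) · Re ψ(¼ + a/2 + it/2)`
(`|Re ψ(¼ + a/2 + it/2)| ≤ C + log(1+|t|)` and `(A + 2 log(1+|t|))/(¼+t²) ∈ L¹`). -/
theorem integrable_archChar_of_decay (a : ℕ) {k : ℝ → ℂ} (hkc : Continuous k) (hks : HasCompactSupport k)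
    {M : ℝ} (hM : ∀ u : ℝ, ‖weilMellin k (1 / 2 + u * I)‖ ≤ M / (1 + u ^ 2)) :
    Integrable fun t : ℝ ↦
      weilMellin k (1 / 2 + t * I) * ((Complex.digamma (1 / 4 + (a : ℂ) / 2 + t / 2 * I)).re : ℂ) := by
  obtain ⟨hcont, C, hC0, hC⟩ := WeilBochnerChar.exists_archWeightChar_bound a
  have hM0 : 0 ≤ M := by
    have h := (norm_nonneg _).trans (hM 0)
    simpa using h
  have hmeas : AEStronglyMeasurable (fun t : ℝ ↦
      weilMellin k (1 / 2 + t * I) * ((Complex.digamma (1 / 4 + (a : ℂ) / 2 + t / 2 * I)).re : ℂ)) volume :=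
    (((continuous_weilMellin hkc hks).comp (by fun_prop : Continuous fun t : ℝ ↦
      (1 / 2 : ℂ) + t * I)).mul (continuous_ofReal.comp hcont)).aestronglyMeasurable
  refine ((PsiOneExplicit.integrable_left_majorant hC0).const_mul M).mono' hmeas
    (ae_of_all _ fun t ↦ ?_)
  have hlog : 0 ≤ Real.log (1 + |t|) := Real.log_nonneg (by linarith [abs_nonneg t])
  rw [norm_mul, Complex.norm_real, Real.norm_eq_abs]
  calc ‖weilMellin k (1 / 2 + t * I)‖ * |(Complex.digamma (1 / 4 + (a : ℂ) / 2 + t / 2 * I)).re|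
      ≤ M / (1 + t ^ 2) * (C + Real.log (1 + |t|)) :=
        mul_le_mul (hM t) (hC t) (abs_nonneg _) (by positivity)
    _ ≤ M * ((C + 2 * Real.log (1 + |t|)) / (1 / 4 + t ^ 2)) := by
        rw [div_mul_eq_mul_div, mul_div_assoc]
        refine mul_le_mul_of_nonneg_left ?_ hM0
        rw [div_le_div_iff₀ (by positivity) (by positivity)]
        nlinarith [mul_nonneg hlog (sq_nonneg t), mul_nonneg hC0 (sq_nonneg t)]

/-! ## The representation on continuous band-limited kernels with nonnegative transform -/

/-- **The `χ`-window measure integrates continuous band-limited kernels.**  Let `μ` represent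
Weil's form `W_χ` on `[-b, b]` (`b > 0`) and let `k` be a continuous kernel with `tsupport k ⊆ [-a, a]`,
`a < 2b`, whose transform on the critical line is a nonnegative real with `‖k̂(½+iu)‖ ≤ M/(1+u²)`.
Then `t ↦ k̂(½+it)` is `μ`-integrable and `W_χ(k) = ∫ k̂(½+it) dμ(t)` (square mollifiers,
Boas–Kac, `n → ∞`, exactly as for `ζ`). -/
theorem weilFunctionalChar_kernel_eq_integral (hb : 0 < b)
    (hμ : ∀ g : ℝ → ℂ, IsWeilTest g → tsupport g ⊆ Icc (-b) b →
      Integrable (fun t : ℝ ↦ ‖weilMellin g (1 / 2 + t * I)‖ ^ 2) μ ∧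
        weilQuadraticChar χ g = ((∫ t, ‖weilMellin g (1 / 2 + t * I)‖ ^ 2 ∂μ : ℝ) : ℂ))
    {k : ℝ → ℂ} (hkc : Continuous k) {a : ℝ} (ha : a < 2 * b) (hkt : tsupport k ⊆ Icc (-a) a)
    {M : ℝ} (hM : ∀ u : ℝ, ‖weilMellin k (1 / 2 + u * I)‖ ≤ M / (1 + u ^ 2))
    (hpos : ∀ u : ℝ, (weilMellin k (1 / 2 + u * I)).im = 0 ∧
      0 ≤ (weilMellin k (1 / 2 + u * I)).re) :
    Integrable (fun t : ℝ ↦ (weilMellin k (1 / 2 + t * I)).re) μ ∧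
      weilFunctionalChar χ k = ((∫ t, (weilMellin k (1 / 2 + t * I)).re ∂μ : ℝ) : ℂ) := by
  have hks : HasCompactSupport k := isCompact_Icc.of_isClosed_subset (isClosed_tsupport k) hkt
  -- the spectral density `F = Re k̂(½+it)` (`k̂` itself is real there)
  set F : ℝ → ℝ := fun t ↦ (weilMellin k (1 / 2 + t * I)).re with hF
  have hkF : ∀ t : ℝ, weilMellin k (1 / 2 + t * I) = (F t : ℂ) := fun t ↦
    Complex.ext (by simp [hF]) (by rw [Complex.ofReal_im]; exact (hpos t).1)
  have hFc : Continuous F := by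
    have h1 : Continuous fun t : ℝ ↦ (1 / 2 : ℂ) + t * I := by fun_prop
    exact Complex.continuous_re.comp ((continuous_weilMellin hkc hks).comp h1)
  have hF0 : ∀ t, 0 ≤ F t := fun t ↦ (hpos t).2
  -- the square mollifiers `ν n = φ_{n+1} ⋆ φ̃_{n+1}`, radius `δ n = 2/(n+2) ≤ 1`
  set ν : ℕ → ℝ → ℂ := fun n ↦ weilConv (moll (n + 1)) (weilReflect (moll (n + 1))) with hν
  set δ : ℕ → ℝ := fun n ↦ 2 * (bump (n + 1)).rOut with hδ
  have hνc : ∀ n, Continuous (ν n) := fun n ↦ continuous_sqMoll (n + 1)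
  have hνt : ∀ n, IsWeilTest (ν n) := fun n ↦ isWeilTest_sqMoll (n + 1)
  have hδ0 : Tendsto δ atTop (𝓝 0) := tendsto_two_mul_bump_rOut.comp (tendsto_add_atTop_nat 1)
  have hδeq : ∀ n, δ n = 2 / ((n : ℝ) + 2) := fun n ↦ by
    simp only [hδ]; rw [two_mul_bump_rOut]; push_cast; ring
  have hδpos : ∀ n, 0 < δ n := fun n ↦ by rw [hδeq]; positivity
  have hδ1 : ∀ n, δ n ≤ 1 := fun n ↦ by
    rw [hδeq, div_le_one (by positivity)]
    have : (0 : ℝ) ≤ n := Nat.cast_nonneg n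
    linarith
  have hνs : ∀ n x, δ n ≤ |x| → ν n x = 0 := fun n x hx ↦ sqMoll_eq_zero hx
  have hν1 : ∀ n, ∫ x, ν n x = 1 := fun n ↦ integral_sqMoll (n + 1)
  have hνn : ∀ n, ∫ x, ‖ν n x‖ = 1 := fun n ↦ integral_norm_sqMoll (n + 1)
  have hνcs : ∀ n, HasCompactSupport (ν n) := fun n ↦ (hνt n).2
  -- the weights `r n t = |φ̂_{n+1}(½+it)|² ∈ [0, 1]`, `→ 1`
  set r : ℕ → ℝ → ℝ := fun n t ↦ Complex.normSq (weilMellin (moll (n + 1)) (1 / 2 + t * I)) with hr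
  have hνline : ∀ n (t : ℝ), weilMellin (ν n) (1 / 2 + t * I) = (r n t : ℂ) := fun n t ↦
    weilMellin_sqMoll_half (n + 1) t
  have hr0 : ∀ n t, 0 ≤ r n t := fun n t ↦ Complex.normSq_nonneg _
  have hr1 : ∀ n t, r n t ≤ 1 := fun n t ↦ by
    simp only [hr]
    rw [Complex.normSq_eq_norm_sq]
    have h := norm_weilMellin_moll_half_le (n + 1) t
    nlinarith [norm_nonneg (weilMellin (moll (n + 1)) (1 / 2 + t * I))]
  have hrlim : ∀ t, Tendsto (fun n ↦ r n t) atTop (𝓝 1) := fun t ↦ by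
    have h := (tendsto_weilMellin_moll (1 / 2 + t * I)).comp (tendsto_add_atTop_nat 1)
    have h2 := (Complex.continuous_normSq.tendsto _).comp h
    simpa [hr, Function.comp_def] using h2
  have hrc : ∀ n, Continuous (r n) := fun n ↦ by
    have h1 : Continuous fun t : ℝ ↦ (1 / 2 : ℂ) + t * I := by fun_prop
    exact Complex.continuous_normSq.comp
      ((continuous_weilMellin (continuous_moll _) (hasCompactSupport_moll _)).comp h1)
  -- the smoothed kernels `G n = k ⋆ ν n`
  set G : ℕ → ℝ → ℂ := fun n ↦ weilConv k (ν n) with hG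
  have hGtest : ∀ n, IsWeilTest (G n) := fun n ↦ by
    refine ⟨?_, ?_⟩
    · simp only [hG]; rw [weilConv_eq_convolution_real]
      exact (hνcs n).contDiff_convolution_right (ContinuousLinearMap.mul ℝ ℂ)
        hkc.locallyIntegrable (hνt n).1
    · simp only [hG]; rw [weilConv_eq_convolution_real]
      exact HasCompactSupport.convolution (L := ContinuousLinearMap.mul ℝ ℂ) hks (hνcs n)
  have hGsupp : ∀ n, tsupport (G n) ⊆ Icc (-(a + δ n)) (a + δ n) := fun n ↦ by
    refine (tsupport_weilConv_subset (h := ν n) hks).trans ?_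
    rintro x ⟨u, hu, v, hv, rfl⟩
    have hu' := hkt hu
    have hv' := tsupport_sqMoll_subset (n + 1) hv
    simp only [mem_Icc] at hu' hv' ⊢
    constructor <;> linarith [hu'.1, hu'.2, hv'.1, hv'.2]
  have hGline : ∀ n (t : ℝ), weilMellin (G n) (1 / 2 + t * I) = ((F t * r n t : ℝ) : ℂ) := by
    intro n t
    simp only [hG]
    rw [weilMellin_weilConv_holds hkc hks (hνc n) (hνcs n), hνline n t, hkF t]
    push_cast; ring
  -- Weil side: `W_χ(G n) → W_χ(k)`
  have hA := integrable_archChar_of_decay (charParity χ) hkc hks hM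
  have hWlim : Tendsto (fun n ↦ weilFunctionalChar χ (G n)) atTop (𝓝 (weilFunctionalChar χ k)) :=
    WeilApproxIdentityChar.tendsto_weilFunctionalChar χ hνc hδ0 hδ1 hνs hν1 hνn hkc hks hA
  -- measure side: for `n` large, `G n` lives on `[-2b, 2b]` and `W(G n) = ∫ F · r n dμ`
  have hev : ∀ᶠ n : ℕ in atTop, δ n ≤ 2 * b - a :=
    (tendsto_order.1 hδ0).2 _ (by linarith) |>.mono fun n hn ↦ hn.le
  have hrep : ∀ n, δ n ≤ 2 * b - a →
      Integrable (fun t ↦ F t * r n t) μ ∧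
        weilFunctionalChar χ (G n) = ((∫ t, F t * r n t ∂μ : ℝ) : ℂ) := by
    intro n hn
    have hGs : tsupport (G n) ⊆ Icc (-(2 * b)) (2 * b) :=
      (hGsupp n).trans (Icc_subset_Icc (by linarith) (by linarith))
    obtain ⟨ψ, hψ, hψs, hψG⟩ := WeilBochner.exists_sq_eq_of_weilMellin_nonneg hb (hGtest n) hGs
      fun t ↦ by
        rw [hGline n t]
        exact ⟨by rw [Complex.ofReal_re]; exact mul_nonneg (hF0 t) (hr0 n t),
          Complex.ofReal_im _⟩
    obtain ⟨hψi, hψQ⟩ := hμ ψ hψ hψs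
    have hsq : ∀ t : ℝ, ‖weilMellin ψ (1 / 2 + t * I)‖ ^ 2 = F t * r n t := fun t ↦ by
      have h := weilMellin_weilConv_weilReflect_half hψ t
      rw [hψG, hGline n t] at h
      exact_mod_cast h.symm
    refine ⟨hψi.congr (ae_of_all _ fun t ↦ hsq t), ?_⟩
    have hQ : weilQuadraticChar χ ψ = weilFunctionalChar χ (G n) := by rw [weilQuadraticChar, hψG]
    rw [← hQ, hψQ]
    congr 1
    exact integral_congr_ae (ae_of_all _ fun t ↦ hsq t)
  -- (1) `F ∈ L¹(μ)` by Fatou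
  have hWre : Tendsto (fun n ↦ (weilFunctionalChar χ (G n)).re) atTop (𝓝 (weilFunctionalChar χ k).re) :=
    (Complex.continuous_re.tendsto _).comp hWlim
  have hptT : ∀ t, Tendsto (fun n : ℕ ↦ F t * r n t) atTop (𝓝 (F t)) := fun t ↦ by
    simpa using (hrlim t).const_mul (F t)
  have hcF0 : ∀ n t, 0 ≤ F t * r n t := fun n t ↦ mul_nonneg (hF0 t) (hr0 n t)
  have hcFle : ∀ n t, F t * r n t ≤ F t := fun n t ↦ mul_le_of_le_one_right (hF0 t) (hr1 n t)
  have hcmeas : ∀ n, Measurable fun t ↦ ENNReal.ofReal (F t * r n t) := fun n ↦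
    (hFc.mul (hrc n)).measurable.ennreal_ofReal
  have hlint : ∫⁻ t, ENNReal.ofReal (F t) ∂μ ≤ ENNReal.ofReal ((weilFunctionalChar χ k).re) := by
    calc ∫⁻ t, ENNReal.ofReal (F t) ∂μ
        = ∫⁻ t, liminf (fun n ↦ ENNReal.ofReal (F t * r n t)) atTop ∂μ := by
          refine lintegral_congr fun t ↦ ?_
          exact ((ENNReal.tendsto_ofReal (hptT t)).liminf_eq).symm
      _ ≤ liminf (fun n ↦ ∫⁻ t, ENNReal.ofReal (F t * r n t) ∂μ) atTop :=
          lintegral_liminf_le hcmeas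
      _ = liminf (fun n ↦ ENNReal.ofReal ((weilFunctionalChar χ (G n)).re)) atTop := by
          refine liminf_congr (hev.mono fun n hn ↦ ?_)
          obtain ⟨hi, hW⟩ := hrep n hn
          rw [← ofReal_integral_eq_lintegral_ofReal hi (ae_of_all _ (hcF0 n)), hW,
            Complex.ofReal_re]
      _ = ENNReal.ofReal ((weilFunctionalChar χ k).re) :=
          ((ENNReal.tendsto_ofReal hWre).liminf_eq)
  have hFint : Integrable F μ := by
    refine ⟨hFc.aestronglyMeasurable, ?_⟩
    rw [hasFiniteIntegral_iff_ofReal (ae_of_all _ hF0)]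
    exact hlint.trans_lt ENNReal.ofReal_lt_top
  -- (2) dominated convergence `∫ F · r n dμ → ∫ F dμ`, and uniqueness of limits
  have hlim : Tendsto (fun n ↦ ∫ t, F t * r n t ∂μ) atTop (𝓝 (∫ t, F t ∂μ)) :=
    tendsto_integral_of_dominated_convergence F
      (fun n ↦ (hFc.mul (hrc n)).aestronglyMeasurable) hFint
      (fun n ↦ ae_of_all _ fun t ↦ by
        rw [Real.norm_eq_abs, abs_of_nonneg (hcF0 n t)]
        exact hcFle n t)
      (ae_of_all _ hptT)
  have hlimC : Tendsto (fun n ↦ (((∫ t, F t * r n t ∂μ : ℝ)) : ℂ)) atTop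
      (𝓝 (((∫ t, F t ∂μ : ℝ)) : ℂ)) :=
    (Complex.continuous_ofReal.tendsto _).comp hlim
  have hWlim' : Tendsto (fun n ↦ (((∫ t, F t * r n t ∂μ : ℝ)) : ℂ)) atTop
      (𝓝 (weilFunctionalChar χ k)) :=
    hWlim.congr' (hev.mono fun n hn ↦ (hrep n hn).2)
  exact ⟨hFint, tendsto_nhds_unique hWlim' hlimC⟩

end Summit.RiemannHypothesis.RiemannHypothesis.Theorems.WeilBochnerMeasureChar

end
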